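import Mathlib.NumberTheory.ModularForms.QExpansion
import HarnessLib

set_option autoImplicit false

/-!
# Crux `PrintCFram.BottomClassIndexLawFiveLe` (stmt-BirchSwinnertonDyer-20372), line `eisenstein-resource-bdp-line` (registry v22–v24):
# LEMMA A OF THE CUSP SEED IN THE KERNEL — the value at the cusp `0` as an Abel limit on the imaginary axis,
# `y^k F(iy) → i^k · (F ∣_k S)(i∞)` as `y → 0⁺` (cell `bsd-print-cfram`, width seat `bsd-line-cfram-p1-w5` g5; THEOREMS ONLY,
# `--supports` 20372; Mathlib currency; BSD is not proved by any of this)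

HONEST FRAMING. General complex-analytic plumbing (no elliptic curve, no BSD): ingredient (A) of the proof plan (crux notes
`Lines/eisenstein-resource-bdp-line-w5g5-cusp-seed.md` §15) for the cusp conjunct «`G = 0 ⟹ ι C = 0`» of `CuspSeed.cuspSeed_of_cutForm`
(p688228): it identifies the constant term at the cusp `0` of an integral-weight form with the Abel limit of its Fourier coefficients at
`∞`, which is the quantity computed (Lemmas B–D there) and numerically certified for the `m`-cut Cohen–Eisenstein series.

For a function `F : ℍ → ℂ` and an integer weight `k`, put `g := F ∣[k] S` (`S = (0 −1; 1 0)`), so that `g(τ) = F(−1/τ) · τ^{−k}`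
(Mathlib `ModularForm.SL_slash_apply`, `UpperHalfPlane.denom_S`). If `g` is periodic of some period `h > 0`, holomorphic and bounded at
`i∞` — e.g. `F` a modular form of weight `k` on a finite-index subgroup, `g` its transform at the cusp `0` — then `g(τ) → valueAtInfty g`
as `τ → i∞` (`tendsto_atImInfty_valueAtInfty`, from Mathlib's `cuspFunction` analyticity) and, substituting `τ = i/y`,
**`y^k · F(iy) → i^k · valueAtInfty (F ∣[k] S)` as `y → 0⁺`** (`tendsto_zpow_mul_apply_ofComplex_I_mul`). This is «Lemma A» of
crux notes `Lines/eisenstein-resource-bdp-line-w5g5-cusp-seed.md` (cell `bsd-print-cfram`, crux `PrintCFram.BottomClassIndexLawFiveLe`):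
the constant term at the cusp `0` of a modular form is read off the Abel means `Σ a(n) e^{−2πny}` of its Fourier coefficients at `∞`
(`F(iy) = Σ a(n)e^{−2πny}`), which is how the cusp constant of the `m`-cut Cohen–Eisenstein series was computed and numerically
certified there. Standard (e.g. the first step of Hecke's proof of the functional equation). [folklore]

References: [DiamondShurman2005] §1.2 (weight-`k` operator, `S`), §5.9; Mathlib `Mathlib.NumberTheory.ModularForms.QExpansion`.
-/

-- summit-side namespace `Summit.BirchSwinnertonDyer.BirchSwinnertonDyer.…` (single-conjunct summit, D-0017 layout)
set_option linter.dupNamespace false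

namespace Summit.BirchSwinnertonDyer.BirchSwinnertonDyer.Theorems.PrintCFram.CuspSeed

open UpperHalfPlane Filter Function
open scoped MatrixGroups ModularForm Topology Manifold

/-- A periodic, holomorphic function on `ℍ` bounded at `i∞` tends to its `valueAtInfty` along `atImInfty` (the `cuspFunction` is
analytic at `q = 0` and equals `f` on `q = 𝕢_h(τ)`, Mathlib). [folklore] -/
theorem tendsto_atImInfty_valueAtInfty {f : ℍ → ℂ} {h : ℝ} (hh : 0 < h)
    (hfper : Periodic (f ∘ ofComplex) h) (hfhol : MDifferentiable 𝓘(ℂ) 𝓘(ℂ) f) (hfbdd : IsBoundedAtImInfty f) :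
    Tendsto f atImInfty (𝓝 (valueAtInfty f)) := by
  have han := analyticAt_cuspFunction_zero hh hfper hfhol hfbdd
  have h0 : cuspFunction h f 0 = valueAtInfty f := cuspFunction_apply_zero hh han hfper
  have hcomp : (cuspFunction h f ∘ fun τ : ℍ ↦ Periodic.qParam h τ) = f := by
    funext τ
    simpa using eq_cuspFunction τ hh.ne' hfper
  have ht := han.continuousAt.tendsto.comp (qParam_tendsto_atImInfty hh)
  rw [hcomp, h0] at ht
  exact ht

/-- For `y > 0`, the point `i/y ∈ ℍ` goes to `i∞` as `y → 0⁺`. [folklore] -/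
theorem tendsto_ofComplex_I_div_nhdsGT_zero :
    Tendsto (fun y : ℝ ↦ ofComplex (Complex.I / (y : ℂ))) (𝓝[>] (0 : ℝ)) atImInfty := by
  rw [atImInfty, tendsto_comap_iff]
  refine (tendsto_inv_nhdsGT_zero (𝕜 := ℝ)).congr' ?_
  filter_upwards [self_mem_nhdsWithin] with y (hy : 0 < y)
  have him : (Complex.I / (y : ℂ)).im = y⁻¹ := by
    rw [div_eq_mul_inv, ← Complex.ofReal_inv, mul_comm, Complex.im_ofReal_mul, Complex.I_im, mul_one]
  have hpos : 0 < (Complex.I / (y : ℂ)).im := by rw [him]; positivity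
  show y⁻¹ = UpperHalfPlane.im (ofComplex (Complex.I / (y : ℂ)))
  rw [ofComplex_apply_of_im_pos hpos]
  exact him.symm

/-- **Lemma A (the cusp `0` as an Abel limit).** If `g := F ∣[k] S` is periodic of period `h > 0`, holomorphic on `ℍ` and bounded at
`i∞`, then `y^k · F(i y) → i^k · valueAtInfty (F ∣[k] S)` as `y → 0⁺` (`F(iy) = F(S·(i/y)) = (i/y)^k · g(i/y)` by `SL_slash_apply`
and `denom_S`). For `F(τ) = Σ_{n≥0} a(n) e^{2πinτ}` this reads `y^k Σ_n a(n) e^{−2πny} → i^k · CT_0(F)`. [folklore] -/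
theorem tendsto_zpow_mul_apply_ofComplex_I_mul {F : ℍ → ℂ} {k : ℤ} {h : ℝ} (hh : 0 < h)
    (hper : Periodic ((F ∣[k] ModularGroup.S) ∘ ofComplex) h)
    (hhol : MDifferentiable 𝓘(ℂ) 𝓘(ℂ) (F ∣[k] ModularGroup.S))
    (hbdd : IsBoundedAtImInfty (F ∣[k] ModularGroup.S)) :
    Tendsto (fun y : ℝ ↦ (y : ℂ) ^ k * F (ofComplex (Complex.I * (y : ℂ)))) (𝓝[>] (0 : ℝ))
      (𝓝 (Complex.I ^ k * valueAtInfty (F ∣[k] ModularGroup.S))) := by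
  set g : ℍ → ℂ := F ∣[k] ModularGroup.S with hg_def
  have hg : Tendsto g atImInfty (𝓝 (valueAtInfty g)) := tendsto_atImInfty_valueAtInfty hh hper hhol hbdd
  -- the identity `y^k F(iy) = i^k g(i/y)` for `y > 0`
  have hid : ∀ y : ℝ, 0 < y → (y : ℂ) ^ k * F (ofComplex (Complex.I * (y : ℂ))) = Complex.I ^ k * g (ofComplex (Complex.I / (y : ℂ))) := by
    intro y hy
    have hy0 : (y : ℂ) ≠ 0 := by exact_mod_cast hy.ne'
    have him : (Complex.I / (y : ℂ)).im = y⁻¹ := by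
      rw [div_eq_mul_inv, ← Complex.ofReal_inv, mul_comm, Complex.im_ofReal_mul, Complex.I_im, mul_one]
    have hpos : 0 < (Complex.I / (y : ℂ)).im := by rw [him]; positivity
    have him' : (Complex.I * (y : ℂ)).im = y := by rw [mul_comm, Complex.im_ofReal_mul, Complex.I_im, mul_one]
    have hpos' : 0 < (Complex.I * (y : ℂ)).im := by rw [him']; exact hy
    set τ : ℍ := ⟨Complex.I / (y : ℂ), hpos⟩ with hτ
    have hτeq : ofComplex (Complex.I / (y : ℂ)) = τ := ofComplex_apply_of_im_pos hpos
    have hS : ModularGroup.S • τ = ofComplex (Complex.I * (y : ℂ)) := by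
      rw [ofComplex_apply_of_im_pos hpos', modular_S_smul]
      apply UpperHalfPlane.ext
      simp only [coe_mk, hτ]
      field_simp
      rw [Complex.I_sq]
    have hgτ : g τ = F (ModularGroup.S • τ) * ((τ : ℂ)) ^ (-k) := by
      rw [hg_def, ModularForm.SL_slash_apply, ModularGroup.denom_S]
    rw [hτeq, hgτ, hS]
    have hτc : ((τ : ℂ)) = Complex.I / (y : ℂ) := rfl
    rw [hτc, zpow_neg, div_zpow, mul_comm (F _)]
    have hI : (Complex.I : ℂ) ^ k ≠ 0 := zpow_ne_zero k Complex.I_ne_zero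
    have hyk : (y : ℂ) ^ k ≠ 0 := zpow_ne_zero k hy0
    field_simp
  have hev : (fun y : ℝ ↦ (y : ℂ) ^ k * F (ofComplex (Complex.I * (y : ℂ)))) =ᶠ[𝓝[>] (0 : ℝ)]
      fun y ↦ Complex.I ^ k * g (ofComplex (Complex.I / (y : ℂ))) := by
    filter_upwards [self_mem_nhdsWithin] with y hy
    exact hid y hy
  rw [tendsto_congr' hev]
  exact (hg.comp tendsto_ofComplex_I_div_nhdsGT_zero).const_mul (Complex.I ^ k)

end Summit.BirchSwinnertonDyer.BirchSwinnertonDyer.Theorems.PrintCFram.CuspSeed
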